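import Mathlib
import Summits.NavierStokesRegularity.NavierStokesRegularity.Theorems.LerayQuarterDissipationFiniteDissipationLiouvilleVorticityAmplitudeJointBudget
import HarnessLib

/-!
# Crux `FiniteDissipationLiouville` (stmt-NavierStokesRegularity-22144): the JOINT velocity /
# vorticity-amplitude region — `λ²C² + (1−λ)(4/√3)C_ω < 1` for some `λ ∈ (0,1]` forces `V ≡ 0`
# (file 2/2)

Theorems file of route `LerayQuarterDissipation` (lead prover g15; `--supports` the crux; portrait
fact for the registered stub `stub_envelopeCriticalLiouville` of skeleton `Lines/birth.lean`; sequel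
of `…VorticityAmplitude`). Navier–Stokes regularity is NOT proved by anything here; no summit is.

`𝒟_{C,K}`: Type-I ancient mild fields `V` (KNSS gauge, `IsTypeIAncientMild C V`: in particular
`√(−t)‖V(t,x)‖ ≤ C`) with the quarter-rate law `∫‖DV(t)‖² ≤ K/√(−t)`; `C_ω` a bound of the
scale-invariant vorticity amplitude `(−t)‖curl V(t,x)‖`. The tree holds the two "pure" rungs
`C < 1 ⇒ V ≡ 0` (`…SimilarityEnstrophy.typeI_ancient_eq_zero_of_rate_lt_one`, stretching priced by
`‖U‖ ≤ C` and absorbed by the dissipation) and `C_ω < √3/4 ⇒ V ≡ 0` (`…VorticityAmplitude`,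
stretching priced by `‖Ω‖ ≤ C_ω`, dissipation discarded). Splitting the stretching term
`2∫φ²⟪DUΩ,Ω⟫ = λ·(…) + (1−λ)·(…)` and pricing the first part by `C` with the Young weight `μ = 1/λ`
(so that it consumes exactly the dissipation `2∫φ²|∇Ω|²_F`) and the second by `C_ω` gives the
budget `Z_R' ≤ −½Z_R + (λ²C²/2 + (1−λ)(2/√3)C_ω)·m + LM/R` and hence:

* (file 1/2 `…VorticityAmplitudeJointBudget`: the `C`-priced stretching bound against `φ_R²` with a free
  Young weight; the budget under a four-term stretching bound `2·str_R ≤ 2D_R + aZ_R + bZ_∞ + (c/R)I`,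
  improving a uniform bound `Z_∞ ≤ m` to `2(a+b)m`;)
* **`eq_zero_of_joint`**, `not_singular_of_joint` — **a member of `𝒟_{C,K}` (any `K`) with
  `(−t)‖curl V‖ ≤ C_ω` everywhere and `λ²C² + (1−λ)(4/√3)C_ω < 1` for some `0 < λ ≤ 1` vanishes
  identically.** Optimising `λ` (`λ* = 2C_ω/(√3C²)` when `≤ 1`): for `C ≥ 1` the region is
  `C_ω < (√3/2)·C²·(1 − √(1 − C⁻²))`, decreasing from `√3/2 ≈ 0.866` at `C = 1` to `√3/4` as
  `C → ∞`; e.g. `C = 1.1 ⇒ C_ω < 0.61`, `C = 1.01 ⇒ C_ω < 0.76` (versus `√3/4 ≈ 0.433` alone);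
* `eq_zero_of_typeI_le_one_of_vorticity_lt` — the corner `C ≤ 1`: **every member with `C ≤ 1` and
  `(−t)‖curl V‖ ≤ C_ω < √3/2` everywhere vanishes identically** (explicit Liouville AT the velocity
  threshold; compare `…ThresholdOne`: `C ≤ 1 ⇒` not singular, all `C_ω`, by compactness);
* `vorticity_exceeds_joint_of_singular` — PORTRAIT: a singular member violates every such joint
  bound somewhere.

HONEST FRAMING. Explicit necessary conditions on the HYPOTHETICAL singular profile in the
`(C, C_ω)` plane; unoptimised beyond the two pricings; nothing removed from the catalogued DSS wall
(`TypeIDSSLiouville`, NECESSARY for the crux); nothing here bears on Navier–Stokes regularity or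
blow-up.

References: Koch–Nadirashvili–Seregin–Šverák, Acta Math. 203 (2009) §4; folklore energy method.
-/

noncomputable section

set_option linter.dupNamespace false

namespace Summit.NavierStokesRegularity.NavierStokesRegularity.Theorems.FiniteDissipationLiouville.VorticityAmplitude

open MeasureTheory Set Filter Topology Metric InnerProductSpace Function Real
open scoped RealInnerProductSpace ContDiff ENNReal Laplacian
open Literature.Analysis Literature.Analysis.FluidPDE
open Summit.NavierStokesRegularity.NavierStokesRegularity.Theorems
open Summit.NavierStokesRegularity.NavierStokesRegularity.Theorems.GaussianGap
open Summit.NavierStokesRegularity.NavierStokesRegularity.Theorems.SimilarityEnstrophy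
open Summit.NavierStokesRegularity.NavierStokesRegularity.Theorems.SmallDissipationGap

variable {C : ℝ} {V : ℝ → (EuclideanSpace ℝ (Fin 3)) → (EuclideanSpace ℝ (Fin 3))}

/-! ### The joint region -/

section Joint

/-- **THE JOINT VELOCITY / VORTICITY-AMPLITUDE LIOUVILLE THEOREM.** Let `V ∈ 𝒟_{C,K}` (any `K`)
satisfy `(−t)‖curl V(t,x)‖ ≤ C_ω` for all `t < 0`, `x`, and suppose
`λ²C² + (1−λ)(4C_ω√3/3) < 1` for some `0 < λ ≤ 1`. Then `V ≡ 0` on `t < 0`: the stretching term is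
split `λ : (1−λ)`, the first part priced by `C` with Young weight `1/λ` (consuming the dissipation,
`two_mul_integral_sqCutoff_stretching_le_typeI`), the second by `C_ω`
(`two_mul_integral_sqCutoff_stretching_le_sharp`); the budget
`integral_sq_norm_lerayVorticity_le_of_forall_le'` contracts the global enstrophy by the ratio
`λ²C² + (1−λ)(4/√3)C_ω < 1`; `Ω ≡ 0` makes every slice constant and the gauge kills constants.
`λ = 1`: the tree's `C < 1`; `λ → 0`: `C_ω < √3/4`. [folklore energy method] -/
theorem eq_zero_of_joint (hV : IsTypeIAncientMild C V) {K : ℝ}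
    (hK : ∀ t : ℝ, t < 0 → ∫⁻ x, ‖fderiv ℝ (V t) x‖ₑ ^ 2 ≤ ENNReal.ofReal (K / Real.sqrt (-t)))
    {Cω : ℝ} (hω : ∀ t : ℝ, t < 0 → ∀ x, (-t) * ‖curl (V t) x‖ ≤ Cω)
    {lam : ℝ} (hlam0 : 0 < lam) (hlam1 : lam ≤ 1)
    (hjoint : lam ^ 2 * C ^ 2 + (1 - lam) * (4 * Cω * Real.sqrt 3 / 3) < 1) :
    ∀ t < 0, ∀ x, V t x = 0 := by
  have hC : 0 ≤ C := hV.nonneg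
  have hΩ : ∀ s y, ‖lerayVorticity V s y‖ ≤ Cω := fun s y =>
    norm_lerayVorticity_le_of_vorticity_le hω s y
  have hCω0 : 0 ≤ Cω := (norm_nonneg _).trans (hΩ 0 0)
  have hΩi := fun σ => integrable_sq_norm_lerayVorticity hV hK σ
  obtain ⟨c₁, hc₁0, hc₁⟩ :=
    exists_norm_fderiv_smoothTransition_cutoff_le (E := (EuclideanSpace ℝ (Fin 3)))
  set M : ℝ := ‖curlCLM‖ ^ 2 * max K 0 with hMdef
  -- the four-term stretching bound
  set a : ℝ := lam ^ 2 * C ^ 2 / 2 with hadef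
  set b : ℝ := (1 - lam) * (2 * Cω * Real.sqrt 3 / 3) with hbdef
  set c : ℝ := lam * (4 * C * c₁) with hcdef
  have ha : 0 ≤ a := by positivity
  have hb : 0 ≤ b := mul_nonneg (by linarith) (by positivity)
  have hc : 0 ≤ c := by positivity
  have hstr : ∀ σ : ℝ, ∀ R : ℝ, 0 < R →
      2 * (∫ y, smoothTransition (2 - ‖y‖ ^ 2 / R ^ 2) ^ 2 *
        ⟪fderiv ℝ (lerayOrbit V σ) y (lerayVorticity V σ y), lerayVorticity V σ y⟫) ≤
        2 * (∫ y, smoothTransition (2 - ‖y‖ ^ 2 / R ^ 2) ^ 2 *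
            frobeniusNormSq (fderiv ℝ (lerayVorticity V σ) y)) +
          a * (∫ y, smoothTransition (2 - ‖y‖ ^ 2 / R ^ 2) ^ 2 * ‖lerayVorticity V σ y‖ ^ 2) +
          b * (∫ y, ‖lerayVorticity V σ y‖ ^ 2) +
          c / R * ∫ y in closedBall (0 : EuclideanSpace ℝ (Fin 3)) (2 * R), ‖lerayVorticity V σ y‖ ^ 2 := by
    intro σ R hR
    have h1 := two_mul_integral_sqCutoff_stretching_le_typeI hV hc₁ hR σ (μ := 1 / lam) (by positivity)
    have h2 := two_mul_integral_sqCutoff_stretching_le_sharp hV hK hCω0 σ (hΩ σ) hR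
    set S := 2 * (∫ y, smoothTransition (2 - ‖y‖ ^ 2 / R ^ 2) ^ 2 *
        ⟪fderiv ℝ (lerayOrbit V σ) y (lerayVorticity V σ y), lerayVorticity V σ y⟫) with hSdef
    set D := ∫ y, smoothTransition (2 - ‖y‖ ^ 2 / R ^ 2) ^ 2 *
        frobeniusNormSq (fderiv ℝ (lerayVorticity V σ) y) with hDdef
    set Z := ∫ y, smoothTransition (2 - ‖y‖ ^ 2 / R ^ 2) ^ 2 * ‖lerayVorticity V σ y‖ ^ 2 with hZdef
    set Zi := ∫ y, ‖lerayVorticity V σ y‖ ^ 2 with hZidef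
    set I := ∫ y in closedBall (0 : EuclideanSpace ℝ (Fin 3)) (2 * R), ‖lerayVorticity V σ y‖ ^ 2 with hIdef
    have hsplit : S = lam * S + (1 - lam) * S := by ring
    have hl1 : lam * S ≤ lam * (2 * (1 / lam) * D + C ^ 2 / (2 * (1 / lam)) * Z + 4 * C * (c₁ / R) * I) :=
      mul_le_mul_of_nonneg_left h1 hlam0.le
    have hl2 : (1 - lam) * S ≤ (1 - lam) * ((2 * Cω * Real.sqrt 3 / 3) * Zi) :=
      mul_le_mul_of_nonneg_left h2 (by linarith)
    have e : lam * (2 * (1 / lam) * D + C ^ 2 / (2 * (1 / lam)) * Z + 4 * C * (c₁ / R) * I) +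
        (1 - lam) * ((2 * Cω * Real.sqrt 3 / 3) * Zi) = 2 * D + a * Z + b * Zi + c / R * I := by
      rw [hadef, hbdef, hcdef]
      field_simp
      ring
    linarith
  -- the contraction ratio
  have hr : 2 * (a + b) = lam ^ 2 * C ^ 2 + (1 - lam) * (4 * Cω * Real.sqrt 3 / 3) := by
    rw [hadef, hbdef]; ring
  have hr1 : 2 * (a + b) < 1 := by rw [hr]; exact hjoint
  have hr0 : 0 ≤ 2 * (a + b) := by positivity
  have hiter : ∀ n : ℕ, ∀ s, ∫ y, ‖lerayVorticity V s y‖ ^ 2 ≤ (2 * (a + b)) ^ n * M := by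
    intro n
    induction n with
    | zero => intro s; rw [pow_zero, one_mul]; exact (hΩi s).2
    | succ n ih =>
        intro s
        calc ∫ y, ‖lerayVorticity V s y‖ ^ 2 ≤ 2 * (a + b) * ((2 * (a + b)) ^ n * M) :=
              integral_sq_norm_lerayVorticity_le_of_forall_le' hV hK ha hb hc hstr ih s
          _ = (2 * (a + b)) ^ (n + 1) * M := by ring
  have hlim : Tendsto (fun n : ℕ => (2 * (a + b)) ^ n * M) atTop (𝓝 (0 * M)) :=
    (tendsto_pow_atTop_nhds_zero_of_lt_one hr0 hr1).mul_const M
  rw [zero_mul] at hlim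
  -- `Ω ≡ 0`
  have hΩ0 : ∀ s y, lerayVorticity V s y = 0 := by
    intro s
    have hcΩ : Continuous (lerayVorticity V s) :=
      (signedBudget_contDiff_lerayVorticity_slice hV s (n := 1)).continuous
    have hE0 : ∫ y, ‖lerayVorticity V s y‖ ^ 2 ≤ 0 := ge_of_tendsto' hlim fun n => hiter n s
    have hE : ∫ y, ‖lerayVorticity V s y‖ ^ 2 = 0 :=
      le_antisymm hE0 (integral_nonneg fun y => sq_nonneg _)
    have hae : (fun y => ‖lerayVorticity V s y‖ ^ 2) =ᵐ[volume] 0 :=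
      (integral_eq_zero_iff_of_nonneg (fun y => sq_nonneg _) (hΩi s).1).1 hE
    have hev : (fun y => ‖lerayVorticity V s y‖ ^ 2) = fun _ => (0 : ℝ) :=
      ((hcΩ.norm.pow 2).ae_eq_iff_eq (μ := volume) continuous_const).1 hae
    intro y
    have hy := congrFun hev y
    have : ‖lerayVorticity V s y‖ = 0 := pow_eq_zero_iff (n := 2) (by norm_num) |>.1 hy
    exact norm_eq_zero.1 this
  -- `V ≡ 0`
  have hcurl : ∀ t < 0, ∀ x, curl (V t) x = 0 := by
    intro t ht x
    set s : ℝ := -Real.log (-t) with hs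
    have hts : -Real.exp (-s) = t := by
      rw [hs, neg_neg, Real.exp_log (neg_pos.2 ht), neg_neg]
    have h := hΩ0 s ((Real.exp (-s / 2))⁻¹ • x)
    rw [lerayVorticity_apply, curl_lerayOrbit, smul_smul,
      mul_inv_cancel₀ (Real.exp_pos _).ne', one_smul, hts, smul_eq_zero] at h
    exact h.resolve_left (Real.exp_pos _).ne'
  have hconst : ∀ t < 0, ∀ x, V t x = V t 0 := fun t ht x =>
    eq_of_curl_eq_zero_of_isDivFree_of_bounded ((hV.contDiff_slice ht).of_le (by norm_cast))
      (hcurl t ht) (hV.isDivFree ht) (fun z => hV.norm_le ht z) x 0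
  exact fun t ht x => hV.eq_zero_of_slice_const (b := fun t => V t 0) hconst ht x

/-- **Regularity form of the joint theorem**, in the quantifier shape of the crux. [folklore] -/
theorem not_singular_of_joint (hV : IsTypeIAncientMild C V) {K : ℝ}
    (hK : ∀ t : ℝ, t < 0 → ∫⁻ x, ‖fderiv ℝ (V t) x‖ₑ ^ 2 ≤ ENNReal.ofReal (K / Real.sqrt (-t)))
    {Cω : ℝ} (hω : ∀ t : ℝ, t < 0 → ∀ x, (-t) * ‖curl (V t) x‖ ≤ Cω)
    {lam : ℝ} (hlam0 : 0 < lam) (hlam1 : lam ≤ 1)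
    (hjoint : lam ^ 2 * C ^ 2 + (1 - lam) * (4 * Cω * Real.sqrt 3 / 3) < 1) :
    ¬ (∀ r > 0, ∀ M : ℝ, ∃ t ∈ Set.Ioo (-(r ^ 2)) (0 : ℝ),
        ∃ x ∈ Metric.ball (0 : EuclideanSpace ℝ (Fin 3)) r, M < ‖V t x‖) := by
  intro hsing
  obtain ⟨t, ht, x, -, hM⟩ := hsing 1 one_pos 0
  rw [eq_zero_of_joint hV hK hω hlam0 hlam1 hjoint t ht.2 x, norm_zero] at hM
  exact lt_irrefl _ hM

/-- **The corner `C ≤ 1`: explicit Liouville at the velocity threshold for vorticity amplitudes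
below `√3/2`.** A member of `𝒟_{C,K}` with `C ≤ 1` and `(−t)‖curl V(t,x)‖ ≤ C_ω < √3/2` for all
`t < 0`, `x` vanishes identically (`λ = 1 − δ` with `δ` small: `(1−δ)² + δ(4/√3)C_ω < 1` iff
`δ < 2 − (4/√3)C_ω`). Compare `…ThresholdOne`: `C ≤ 1 ⇒` not singular for EVERY `C_ω`, by
compactness; here `V ≡ 0` outright, explicitly, on `C_ω < √3/2 ≈ 0.866`. [folklore energy method] -/
theorem eq_zero_of_typeI_le_one_of_vorticity_lt (hV : IsTypeIAncientMild C V) (hC1 : C ≤ 1) {K : ℝ}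
    (hK : ∀ t : ℝ, t < 0 → ∫⁻ x, ‖fderiv ℝ (V t) x‖ₑ ^ 2 ≤ ENNReal.ofReal (K / Real.sqrt (-t)))
    {Cω : ℝ} (hCω : Cω < Real.sqrt 3 / 2) (hω : ∀ t : ℝ, t < 0 → ∀ x, (-t) * ‖curl (V t) x‖ ≤ Cω) :
    ∀ t < 0, ∀ x, V t x = 0 := by
  have hC : 0 ≤ C := hV.nonneg
  have hCω0 : 0 ≤ Cω :=
    (norm_nonneg _).trans (norm_lerayVorticity_le_of_vorticity_le hω 0 0)
  have h3 : Real.sqrt 3 ^ 2 = 3 := Real.sq_sqrt (by norm_num)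
  have hs0 : 0 < Real.sqrt 3 := Real.sqrt_pos.2 (by norm_num)
  -- `q = (4/√3) C_ω < 2`
  set q : ℝ := 4 * Cω * Real.sqrt 3 / 3 with hq
  have hq0 : 0 ≤ q := by positivity
  have hq2 : q < 2 := by
    rw [hq]
    have : Cω * Real.sqrt 3 < Real.sqrt 3 / 2 * Real.sqrt 3 := mul_lt_mul_of_pos_right hCω hs0
    nlinarith
  -- `λ = 1 − δ`, `δ = (2 − q)/4 ∈ (0, 1/2]`
  set δ : ℝ := (2 - q) / 4 with hδ
  have hδ0 : 0 < δ := by rw [hδ]; linarith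
  have hδ1 : δ ≤ 1 / 2 := by rw [hδ]; linarith
  refine eq_zero_of_joint hV hK hω (lam := 1 - δ) (by linarith) (by linarith) ?_
  have hC2 : C ^ 2 ≤ 1 := by nlinarith
  have h1 : (1 - δ) ^ 2 * C ^ 2 ≤ (1 - δ) ^ 2 := mul_le_of_le_one_right (sq_nonneg _) hC2
  have h2 : (1 - δ) ^ 2 + (1 - (1 - δ)) * q < 1 := by
    have e : (1 - δ) ^ 2 + (1 - (1 - δ)) * q - 1 = δ * (δ - (2 - q)) := by ring
    have hneg : δ * (δ - (2 - q)) < 0 := mul_neg_of_pos_of_neg hδ0 (by rw [hδ]; linarith)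
    linarith
  rw [← hq]
  linarith

/-- **PORTRAIT: a singular member violates every joint bound somewhere.** If `V ∈ 𝒟_{C,K}` is
singular at the apex, then for every `0 < λ ≤ 1` and every `C_ω` with
`λ²C² + (1−λ)(4/√3)C_ω < 1` there are `t < 0`, `x` with `C_ω < (−t)‖curl V(t,x)‖`. [folklore] -/
theorem vorticity_exceeds_joint_of_singular (hV : IsTypeIAncientMild C V) {K : ℝ}
    (hK : ∀ t : ℝ, t < 0 → ∫⁻ x, ‖fderiv ℝ (V t) x‖ₑ ^ 2 ≤ ENNReal.ofReal (K / Real.sqrt (-t)))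
    (hsing : ∀ r > 0, ∀ M : ℝ, ∃ t ∈ Set.Ioo (-(r ^ 2)) (0 : ℝ),
        ∃ x ∈ Metric.ball (0 : EuclideanSpace ℝ (Fin 3)) r, M < ‖V t x‖)
    {lam : ℝ} (hlam0 : 0 < lam) (hlam1 : lam ≤ 1) {Cω : ℝ}
    (hjoint : lam ^ 2 * C ^ 2 + (1 - lam) * (4 * Cω * Real.sqrt 3 / 3) < 1) :
    ∃ t : ℝ, t < 0 ∧ ∃ x, Cω < (-t) * ‖curl (V t) x‖ := by
  by_contra h
  push Not at h
  exact not_singular_of_joint hV hK (fun t ht x => h t ht x) hlam0 hlam1 hjoint hsing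

end Joint

end Summit.NavierStokesRegularity.NavierStokesRegularity.Theorems.FiniteDissipationLiouville.VorticityAmplitude

end
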